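import Mathlib
import HarnessLib
import HarnessLib.Audit
import Summits.NavierStokesRegularity.Statement
import Literature.Analysis.FluidPDE.NSFourierMild
import Literature.Analysis.FluidPDE.NSFourierData
import HarnessLib.Audit.Status.Attr

/-!
Route: FrozenSignCascade

Route FrozenSignCascade — NavierStokesRegularity (Clay A), POSITIVE side, Fourier/cascade line. Card
realised: NavierStokesRegularity/NavierStokesRegularity/frozen-sign-cascade-rigidity (absorbs
phase-frustrated-cascade). Rev 2 (route-repair 2026-08-15): rerouted off the Tao-class vocabulary —
the route file imports only Literature.Analysis.FluidPDE.NSFourierMild + NSFourierData, and (B)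
lands directly in the Clay predicates of NSWave0; no unproved named fact sits in the import cone of
any item beyond the Statement's own module.

THESIS X ("it suffices to show"), two conjuncts over in-tree Fourier-side notions
(Literature.Analysis.FluidPDE.FourierNS.IsFourierMild, .fourierData) landing in the Clay matrix
(IsSmoothOnHalfSpace, IsNavierStokesSolution, HasBoundedEnergy):
(A) ENVELOPE BOUND. For every ν>0 and every Clay datum u₀ (C^∞, divergence-free, rapidly decaying)
and every horizon T₀>0 there is C = C(ν,u₀,T₀) such that every Fourier-side mild solution V of
Navier–Stokes on [0,T], T ≤ T₀, issued from the Fourier datum a = 𝓕⁻u₀ (IsFourierMild (4π²ν) 4 0 T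
V, V 0 = fourierData) satisfies  sup_{t≤T} sup_ξ |ξ|²‖V(t,ξ)‖ ≤ C.  The quantity sup_ξ |ξ|²|û(ξ)| is
the Le Jan–Sznitman / Sinai Φ(2) / Cannone–Karch PM² norm: SCALE-INVARIANT under u ↦ λu(λx,λ²t) and
translation-invariant, i.e. a critical a-priori bound, stated on the Fourier side where the card's
object (the signed Duhamel-tree cascade) lives.
(B) BOUNDED-ENVELOPE CONTINUATION. If the envelope is bounded at every horizon, then u₀ launches a
GLOBAL smooth solution with bounded energy — the Clay (A) conclusion for that datum, verbatim (∃ u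
p, IsSmoothOnHalfSpace u ∧ IsSmoothOnHalfSpace p ∧ IsNavierStokesSolution ν 0 u₀ u p ∧
HasBoundedEnergy u). Its content is the q=∞ endpoint continuation criterion; the passage 'Tao-class
solution on every [0,T] ⇒ Clay' is proved tree machinery (IsTaoSolutionOn.global_of_nat +
isNavierStokesSolution_and_smooth_iff) used inside B's proof, imported by the prover's Theorems file
and not by the route.
Lean: X := EnvelopeBound ∧ BoundedEnvelopeContinuation (route decls; planner's Sketch.lean rc 0 with
the rev-2 imports), with
 EnvelopeBound := ∀ ν>0, ∀ u₀ (hu : ContDiff ℝ ⊤ u₀) (hd : HasRapidSpatialDecay u₀), IsDivFree u₀ →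
∀ T₀>0, ∃ C, ∀ T ≤ T₀, ∀ V, FourierNS.IsFourierMild (4·π²·ν) 4 0 T V → V 0 = FourierNS.fourierData
hu hd → ∀ t ∈ Icc 0 T, ∀ ξ, ‖ξ‖²·‖V t ξ‖ ≤ C;
 BoundedEnvelopeContinuation := ∀ ν>0, ∀ u₀ hu hd, IsDivFree u₀ → (envelope bounds as above, at
every horizon) → ∃ u p, IsSmoothOnHalfSpace u ∧ IsSmoothOnHalfSpace p ∧ IsNavierStokesSolution ν 0
u₀ u p ∧ HasBoundedEnergy u.

DECIDING THEOREM (D-0027): closes (hA : EnvelopeBound) (hB : BoundedEnvelopeContinuation) :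
NavierStokesRegularity — PURE LOGIC, two lines (fix ν, u₀; A gives the envelope bounds at every
horizon, B turns them into the Clay conclusion for u₀); axioms propext/Classical.choice/Quot.sound
only. The Assembly item records the same implication. TwoClusterEnvelopeBound (special case of A,
implication twoCluster_of_envelope in Sketch.lean) and TightEnvelopeContinuation (support toward B)
are items but not hypotheses of closes.

DICHOTOMY behind X. A blow-up of a REAL flow must either OVERSHOOT the critical Fourier envelope
|ξ|^{-2} without bound — a coherent low-to-high amplitude cascade, the mechanism of every known
Fourier-side blow-up engine: cheap NS (even symbol |ξ|, û ≥ 0 preserved), Li–Sinai complex NS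
(one-sided Fourier support), positive dyadic pumps, Tao's averaged gates — or RIDE it with bounded
envelope (locally (−1)-homogeneous / discretely self-similar focusing, |x|^{-1} profile tails ∈
PM²). (A) says real flows cannot overshoot: with û = i·v the recursion is real and reality ⇔ v ODD,
so every 'difference' interaction (p,−q) enters with the sign opposite to its 'sum' partner (p,q)
while the incompressible null form v(p)·q kills collinear sign-stable geometry — backscatter is
hard-wired destructive and the unsigned majorant of the Duhamel-tree (Le Jan–Sznitman / Gubinelli)
series, which IS the cheap-NS cascade, is never attained. (B) says real flows cannot ride it either:
the q=∞ endpoint of the ESS/GKP/Cheskidov–Shvydkoy critical-norm criteria.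

Rationale: WHY THIS LINE. Every Fourier-side blow-up engine for NS-type equations is a ONE-SIGNED coherent
cascade: cheap NS (even symbol |ξ|, û≥0 preserved; MontgomerySmith2001, LemarieRieusset2016 Thm 11.1
p.313 / §8.7 'cheap equation' majorant W = W⁰ + B₀(W,W), book pp.185–190), complex Li–Sinai
(one-sided Fourier support, power series with positive coefficients; LiSinai2008 §9–10), positive
dyadic pumps (KatzPavlovic; barrier DyadicCascadeRegularity), Tao's averaged pump/amplifier/rotor
gates tuned by imaginary-order multipliers |D|^{it} (arXiv:1402.0290 §1.2). For a REAL flow, û = i·v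
makes the recursion real with v ODD; oddness forces both clusters ±k to be present with opposite
signs, every difference interaction is anti-signed to its sum partner, and the null form v(p)·q
forbids collinear sign-stable escape. Nobody has spent this: Costin–Luo–Tanveer state their
Borel-plane bounds "do not take into account that the data are real valued" and ignore cancellations
(CostinLuoTanveer2011 = arXiv:0808.3721 p.5); Flandoli–Romito: cancellations exist but absolute
convergence destroys them (FlandoliRomito2016 pp.8–10); every convergence theorem for the
Duhamel-tree / stochastic-cascade series is by majorants (LeJanSznitman1997; Bhattacharya et al.
TAMS 2003 doi:10.1090/s0002-9947-03-03246-x; Gubinelli2006; DascaliucPhamThomann2024); the one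
numerical look at the real (antisymmetrised) Li–Sinai datum shows enstrophy ×20 then decay
(arXiv:1910.13833; BoldrighiniEtAl2023, who call real blow-up 'open', p.108). Imported areas:
branching-process / rooted-tree expansions (probability, B-series combinatorics) for the object;
Borel–Laplace resummation in inverse time (CostinLuoTanveer2011) as the device that makes the signed
sum meaningful where the majorant explodes (refuter-3 caveat on the card: the functional is
multiplicative, cancellation lives in E[M] across trees, not in E|M|², so a resummation variable is
load-bearing); critical-space regularity theory (ESS/GKP/Cheskidov–Shvydkoy) for the landing. The
card's perturbative claim (N1) is therefore RESTATED DYNAMICALLY as the a-priori envelope bound (A):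
it is what a successful signed-cascade/Borel argument outputs, it is scale-critical (so not excluded
by scaling), and it is exactly violated by every one-signed engine above.
RANKED CRUXES. #2 EnvelopeBound (A) — hardest, the thesis' heart; the card's mechanism lives here
(signed Le Jan–Sznitman/Gubinelli tree sums for odd data, resummed in the Costin–Tanveer Borel
plane; target output |v(t,ξ)| ≤ C(t)·|ξ|^{-2}). #3 TwoClusterEnvelopeBound — A for real data with
Fourier support in B(k₀,|k₀|/4) ∪ B(−k₀,|k₀|/4), the real Li–Sinai/BFMPS class: binary sign
structure, 1-D-like cascade along k₀, existing numerics; the calibration rung and cheapest kill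
(with B it already gives global regularity of that class, asked as open in BoldrighiniEtAl2023). #4
BoundedEnvelopeContinuation (B) — bounded critical envelope at every horizon ⇒ global smooth
bounded-energy (Clay) solution for that datum; its content is the genuinely open q=∞ endpoint
continuation criterion (PM² ⊂ Ḃ^{-1}_{∞,∞} ∩ Ḃ^{1/2}_{2,∞}; ESS/GKP2016/Albritton2018 need L³ or
q<∞, CheskidovShvydkoy2010 needs small jumps); must exclude envelope-RIDING blow-up (backward DSS
with |x|^{-1} tails; Landau-type profiles are PM²-bounded, CannoneKarch2004 §2–3); the final
patching 'Tao-class on every [0,n+1] ⇒ Clay' is proved tree machinery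
(IsTaoSolutionOn.global_of_nat, isNavierStokesSolution_and_smooth_iff) used in the Theorems file.
SUPPORT: TightEnvelopeContinuation (tight envelope at every horizon ⇒ the same Clay conclusion:
local existence time in the closure of 𝒮 in Ḃ²_{PM,∞} is controlled by limsup_{A→∞}
sup_{|ξ|>A}|ξ|²|û₀| — LemarieRieusset2016 Thm 8.21 and its proof, book p.190; restart with the
tree's NSFourierPicard/NSFourierRestart machinery, then the same patching; refuter caveat: needs a
PM²-level local theory plus persistence of the K₀=4 weights, difficulty M–L). Rev 2 dropped the
former support item TaoClassGlobalToClay (its statement needed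
Literature.Analysis.FluidPDE.TaoClassGlue, whose import cone carries 16+ unproved named facts none
of which any item uses; its content is folded into B).
TWO-LAYER PLAN (D-0019). Layer 1 = the three cruxes + one support item + assembly; layer 2 (by glued
splits, only after a crux moves): A ⇐ {two-cluster case, signed generation bounds in the Borel
variable, no-frozen-sign-pump lemma}; B ⇐ {bounded ⇒ tight envelope near T* (the open part),
TightEnvelopeContinuation (support, known-type)}.
KILL CRITERIA. (i) A refuted ⇒ route closed refuted:EnvelopeBound unless the witness is
complex/non-odd (then it only re-confirms barrier ComplexNavierStokesBlowup). Probes: an explicit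
finite true-NS triad circuit realising Tao's pump–amplifier–rotor at leading order with frozen signs
(card (b)); a REAL Li–Sinai RG fixed point with real critical amplitude (BoldrighiniLiSinai2017
framework; card (c)) kills A and TwoCluster at once; numerics (signed vs unsigned LJS tree sums,
pseudo-spectral run of the antisymmetrised Li–Sinai datum tracking sup|ξ|²|v|) bear on A only
through DIVERGENCE, not through bounded transient growth (refuter calibration: K41 gives k²|û|
rising like k^{1/6} up to k_d, so any proof of A outputs a ν-dependent constant). (ii) TwoCluster
refuted ⇒ A refuted. (iii) B refuted = an envelope-bounded blow-up = ¬NavierStokesRegularity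
outright (hand to route Blowup). (iv) NoBlowup (stmt-0054) proved elsewhere moots the route; B
proved elsewhere (any L^∞_t Ḃ^{-1}_{∞,∞}-type endpoint criterion) halves it.
NOT DECOMPOSED YET (deliberately). The card's (N3) 'no frozen-sign pump gate' finite-dimensional
rigidity lemma: its naive Galerkin forms are either trivially true (energy-conserving reversible
quadratic systems admit no subspace energy monotone along all trajectories) or ill-typed; it is the
first task of A's prover/refuter to give it a sharp form (leading-order triad CLUSTERS with odd
amplitudes vs Tao's five-mode circuit, TaoCascadeFiveModes in tree) — it will enter as a layer-2
child of A or via --supports. The Borel-plane equivalence 'global classical ⇔ subexponential Borel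
transform' (CostinLuoTanveer2011 Thm 2.1–2.2/Cor 2.2, on T³) is a proof DEVICE for A here, not an
item; its ℝ³/Clay transfer and the Tauberian sign criterion belong to card borel-plane-reality
(separate plancard). No PM²-valued solution theory is posited: everything is stated on
IsFourierMild, whose conjSymm field IS the reality hypothesis. B is not split at open ('bounded ⇒
tight near T*' + TightEnvelopeContinuation is the foreseen split).
CHEAPEST FALSIFIER. An explicit frozen-sign realisation of Tao's five-mode pump–amplifier–rotor
circuit (TaoCascadeFiveModes in tree; arXiv:1402.0290 §1.2) inside true-NS triad clusters at leading
order — a finite computation with the exact symbol m_{jkl}(ξ)=ξ_j(δ_kl−ξ_kξ_l/|ξ|²) on odd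
amplitudes: if the gate signs can be frozen without the |D|^{it} phases, A is dead in spirit (kill
(i)(b)); second cheapest: the two-cluster (real Li–Sinai) recursion along multiples of k₀, whose
binomially signed generation weights either stay O(|ξ|^{-2}) or exhibit a coherent odd-multiple
sub-cascade (kill (ii)).
NUMBERS. Small-envelope global theory: sup|ξ|²|û₀| < c·ν ⇒ global (LeJanSznitman1997;
LemarieRieusset2016 Thm 8.19/8.21; CannoneKarch2004 Thm 4.1; ArnoldSinai2008 on T³); cheap NS blows
up from û₀ ≥ 0 with mass > 36e^{40ν/9} near a unit frequency by t=1 (LemarieRieusset2016 p.314);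
Li–Sinai: E ~ (Δt)^{-5}, enstrophy ~ (Δt)^{-7} at the complex critical amplitude (LiSinai2008 §10);
BFMPS real antisymmetric run: enstrophy growth ≈ ×20 then decay (arXiv:1910.13833). Items after rev
2: 5 (3 cruxes, 1 support, 1 assembly) + the deciding theorem closes; negatives index read
2026-08-15 (0 refuted statements on the summit); needs-fact: NONE.

Novelty: NOVELTY (route level; searched 2026-08-15 — `lit frontier NavierStokesRegularity --since 2022` (30
rows: forward self-similar 2-D, sharp non-uniqueness, boundary ε-regularity, 'Energy based near
singularity for Fourier spectral NS' arXiv:2604.23159 — nothing on signed cascades or PM² criteria);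
`lit search --source zbmath` ×5: "Le Jan Sznitman Navier-Stokes" (12: LJS 1997 ×2, Bhattacharya et
al. 2003 majorizing kernels, Waymire 2005 survey, Gubinelli2006 rooted trees, DMTW 2019 complex
Burgers, Yule cascades I/II 2023, DascaliucPhamThomann2024), "pseudo-measures Navier-Stokes" (5:
ArnoldSinai2008 Φ(α) small data on T³, CannoneKarch2004, Gubinelli2006, two 2026 decay papers),
"Navier-Stokes regularity criterion Fourier space" (12: Ri 2020 finite-frequency-parts criteria
doi:10.1016/j.na.2019.111619, Luo 2019 frequency-localised BKM arXiv:1803.05569 — L³/BKM-type, none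
at the PM²/q=∞ endpoint), "complex solutions Navier-Stokes real solutions Sinai" (5:
BoldrighiniLiSinai2017, BoldrighiniEtAl2023, BFMPS 2020, arXiv:1910.13833), "stochastic cascades
Navier-Stokes explosion" (7: DMTW 2015 arXiv:1502.06939, Yule I/II, arXiv:2509.10806 fractional);
`lit search --hybrid` local ×2 and `lit vsearch` (held: LemarieRieusset2016 §8.7–8.8 pp.185–190 read
— majorant 'cheap equation', Thm 8.19, Thm 8.21; Cannone's Paseky notes book:malek2000 pp.14–18 on
the LJS space); `lit read` arXiv:math/0210234 (CannoneKarch2004 §2–4: PM² contains the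
(−1)-homogeneous Landau/Tian–Xin singular solutions;  [refs: 10.1016/j.na.2019.111619, 10.1007/s004400050135, 10.1090/s0002-9947-03-03246-x, 10.4310/pamq.2008.v4.n1.a2, 10.4310/dpde.2006.v3.n2.a3, 10.1090/tran/8974, 2604.23159, 1803.05569, 1910.13833, 1502.06939, 2509.10806, math/0210234, math-ph/0511041, 0808.3721, 1204.5444, doi:10.1016/j.na.2019.111619, book:malek2000, doi:10.1007/s004400050135, doi:10.1090/s0002-9947-03-03246-x, doi:10.4310/pamq.2008.v4]

Barriers (technique_class: signed-cascade sup-type-critical-norm-regularity-criterion): BARRIERS (catalogue Literature/Barriers/NavierStokesRegularity read: 13 structured entries +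
dyadic/energy files; technique_class: signed-cascade sup-type-critical-norm-regularity-criterion
(informally also: fourier-sign-rigidity, critical-fourier-envelope, borel-plane-resummation)).
- Literature.Barriers.NavierStokesRegularity.CheapNavierStokesBlowup: kills every argument surviving
passage to |û| (semigroup/majorant/'magnitude-only Fourier estimates'). Evaded BY CONSTRUCTION: crux
A is false for the cheap symbol (its doubling cascade w_{n+1}=w_n∗w_n overshoots every C|ξ|^{-2}
envelope by t=1, LemarieRieusset2016 p.314), so any proof of A must use the sign pattern of the true
symbol m_{jkl}(ξ)=ξ_j(δ_kl−ξ_kξ_l/|ξ|²) (odd, real) — the route's whole content; the majorant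
W=W⁰+B₀(W,W) (ibid. §8.7) is used only as the object cancellation is measured against. Honest cost:
no estimate in the route may be closed in absolute value at the critical level.
- Literature.Barriers.NavierStokesRegularity.ComplexNavierStokesBlowup (Li–Sinai): kills
real-structure-insensitive / formal power-series arguments. Evaded in hypothesis: every item is
stated on IsFourierMild, whose conjSymm field (V(t,−ξ)=conj V(t,ξ), i.e. u real, v odd) is used in
every step; A is FALSE verbatim for Li–Sinai's one-sided complex data (energy blow-up ⇒ envelope
blow-up, since their support {|ξ_⊥|² ≲ |ξ_∥|} has ∫|ξ|^{-4} < ∞), which is the route's consistency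
check, and the card's refutation (c) (a REAL RG fixed point)

History (route lifecycle, newest last):
- 2026-08-15T16:18:48Z · rev 2: restated BoundedEnvelopeContinuation (stmt-NavierStokesRegularity-1551), TightEnvelopeContinuation (stmt-NavierStokesRegularity-1552), Assembly (stmt-NavierStokesRegularity-1554) — route-repair rbadge-…-e3cf0f4c-g4 (glue.missing + cone): imports 3→2 (Literature.Analysis.FluidPDE.TaoClassGlue dropped — the only c (planner-rbadge-NavierStokesRegularity-FrozenSi-e3cf0f4c-g4-0)
- 2026-08-15T16:18:48Z · rev 2: dropped TaoClassGlobalToClay — route-repair rbadge-…-e3cf0f4c-g4 (glue.missing + cone): imports 3→2 (Literature.Analysis.FluidPDE.TaoClassGlue dropped — the only carrier of the 16 listed unpr (planner-rbadge-NavierStokesRegularity-FrozenSi-e3cf0f4c-g4-0)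

sub-problem: NavierStokesRegularity · status: open · opened planner-plancard-NavierStokesRegularity-Navie-d08d0da1-0 2026-08-15T10:57:21Z · rev 2 · ledger route-NavierStokesRegularity-FrozenSignCascade
GENERATED by the gate from the ledger (D-0016/17). Provers cite these decls: `theorem foo : Summit.NavierStokesRegularity.NavierStokesRegularity.Theses.FrozenSignCascade.<Decl> := …` in Summits/NavierStokesRegularity/NavierStokesRegularity/Theorems/<Name>.lean.
-/

namespace Summit.NavierStokesRegularity.NavierStokesRegularity.Theses.FrozenSignCascade

open scoped BigOperators Topology Manifold Classical MeasureTheory ProbabilityTheory Matrix InnerProductSpace ComplexConjugate ContinuousMap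
open Filter Set Function TopologicalSpace MeasureTheory

attribute [summit_statement] _root_.NavierStokesRegularity

open Literature.NS

/-- item stmt-NavierStokesRegularity-1549 · crux · rank 2 · open · by planner
why it might fail: Critical a-priori bound across the supercritical gap with no coercive quantity; Tao's averaged B̃ is real with real solutions and blows up, so only the exact frozen sign PATTERN can work — if true-NS triad clusters realise his pump/amplifier/rotor gates, A is false in spirit and likely in fact.
sources: CostinLuoTanveer2011, LeJanSznitman1997, Gubinelli2006, LemarieRieusset2016, LiSinai2008, arXiv:1402.0290
[crux] (A) ENVELOPE BOUND — the card's mechanism lives here. For every ν>0, Clay datum u₀ and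
horizon T₀, every Fourier-side mild solution V on [0,T], T ≤ T₀, from a = 𝓕⁻u₀ (IsFourierMild (4π²ν)
4 0 T V, V 0 = fourierData) obeys sup_ξ |ξ|²‖V(t,ξ)‖ ≤ C(ν,u₀,T₀): real flows never OVERSHOOT the
scale-critical envelope |ξ|^{-2} (Le Jan–Sznitman / PM² / Sinai Φ(2) norm, scale- and
translation-invariant). Intended proof technology (card N1+N2 restated per refuter-3): with v = −iû
the recursion is real and u real ⇔ v odd; expand V in the Duhamel rooted-tree / Le Jan–Sznitman
cascade series whose UNSIGNED majorant is the cheap-NS cascade W = W⁰+B₀(W,W) (LemarieRieusset2016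
§8.7, pp.185–190; Gubinelli2006); pair trees by leaf-sign involutions ((p,q)↔(p,−q): difference
interactions are anti-signed for odd v; the null form v(p)·q kills collinear sign-stable routings)
to bound GENERATION sums |Σ_{|τ|=n} M(τ)| rather than E|M|², and make the signed sum meaningful
beyond the majorant's radius by resummation in the Costin–Tanveer Borel variable q dual to 1/t
(CostinLuoTanveer2011 Thms 2.1–2.2: globally solvable q-equation, growth type = inverse existence
time; p.5: their bounds ignore reality and -/
@[route_item "route-NavierStokesRegularity-FrozenSignCascade", crux]
def EnvelopeBound : Prop :=
  ∀ ν : ℝ, 0 < ν → ∀ (u₀ : EuclideanSpace ℝ (Fin 3) → EuclideanSpace ℝ (Fin 3)) (hu : ContDiff ℝ (⊤ : ℕ∞) u₀) (hd : Literature.Analysis.FluidPDE.HasRapidSpatialDecay u₀), Literature.Analysis.FluidPDE.NSWave0.IsDivFree u₀ → ∀ T₀ : ℝ, 0 < T₀ → ∃ C : ℝ, ∀ T : ℝ, T ≤ T₀ → ∀ V : ℝ → EuclideanSpace ℝ (Fin 3) → Fin 3 → ℂ, Literature.Analysis.FluidPDE.FourierNS.IsFourierMild (4 * Real.pi ^ 2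 * ν) 4 0 T V → V 0 = Literature.Analysis.FluidPDE.FourierNS.fourierData hu hd → ∀ t ∈ Set.Icc 0 T, ∀ ξ : EuclideanSpace ℝ (Fin 3), ‖ξ‖ ^ 2 * ‖V t ξ‖ ≤ C

/-- item stmt-NavierStokesRegularity-1550 · crux · rank 3 · open · by planner
why it might fail: BFMPS numerics reach only moderate amplitude (enstrophy ×20, then decay); at larger amplitude the binary sign pattern may still admit a coherent sub-cascade (e.g. along odd multiples of k₀ only), and a REAL Li–Sinai RG fixed point would give blow-up in exactly this class.
sources: arXiv:1910.13833, BoldrighiniEtAl2023, BoldrighiniLiSinai2017, LiSinai2008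
[crux] CALIBRATION RUNG: EnvelopeBound restricted to real data whose Fourier datum vanishes outside
B(k₀,‖k₀‖/4) ∪ B(−k₀,‖k₀‖/4), k₀ ≠ 0 — the real (antisymmetrised) Li–Sinai / BFMPS class, where the
sign structure is binary (leaves ±k₀; generation-n trees feed frequencies m·k₀, m ≡ n mod 2, with
binomially signed weights) and the cascade is 1-D-like along k₀. Special case of EnvelopeBound
(implication twoCluster_of_envelope proved in the planner's Sketch.lean); together with
BoundedEnvelopeContinuation it gives global regularity of this class, recorded as open in
BoldrighiniEtAl2023 (p.108). Cheapest refutation of the whole line: a pseudo-spectral / kit run of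
the antisymmetrised Li–Sinai datum at 2–5× the majorant (cheap-NS) threshold tracking
sup|ξ|²|v(t,ξ)|, or Monte-Carlo of signed vs unsigned LJS tree sums (card refutation (a)); a real RG
fixed point with real critical amplitude in the BoldrighiniLiSinai2017 framework refutes it
analytically (card (c)). Not known to be easier than general data: fixed relative bandwidth 1/4, not
the Chemin–Gallagher oscillating/anisotropic regime. -/
@[route_item "route-NavierStokesRegularity-FrozenSignCascade"]
def TwoClusterEnvelopeBound : Prop :=
  ∀ ν : ℝ, 0 < ν → ∀ (u₀ : EuclideanSpace ℝ (Fin 3) → EuclideanSpace ℝ (Fin 3)) (hu : ContDiff ℝ (⊤ : ℕ∞) u₀) (hd : Literature.Analysis.FluidPDE.HasRapidSpatialDecay u₀), Literature.Analysis.FluidPDE.NSWave0.IsDivFree u₀ → (∃ k₀ : EuclideanSpace ℝ (Fin 3), k₀ ≠ 0 ∧ ∀ ξ, Literature.Analysis.FluidPDE.FourierNS.fourierData hu hd ξ ≠ 0 → ξ ∈ Metric.ball k₀ (‖k₀‖ / 4) ∪ Metric.ball (-k₀) (‖k₀‖ / 4)) → ∀ T₀ : ℝ, 0 < T₀ → ∃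 C : ℝ, ∀ T : ℝ, T ≤ T₀ → ∀ V : ℝ → EuclideanSpace ℝ (Fin 3) → Fin 3 → ℂ, Literature.Analysis.FluidPDE.FourierNS.IsFourierMild (4 * Real.pi ^ 2 * ν) 4 0 T V → V 0 = Literature.Analysis.FluidPDE.FourierNS.fourierData hu hd → ∀ t ∈ Set.Icc 0 T, ∀ ξ : EuclideanSpace ℝ (Fin 3), ‖ξ‖ ^ 2 * ‖V t ξ‖ ≤ C

-- earlier BoundedEnvelopeContinuation (stmt-NavierStokesRegularity-1551, replaced 2026-08-15T16:18:48Z -> stmt-NavierStokesRegularity-10579): retired by None — ∀ ν : ℝ, 0 < ν → ∀ (u₀ : EuclideanSpace ℝ (Fin 3) → EuclideanSpace ℝ (Fin 3)) (hu : ContDiff ℝ (⊤ : ℕ∞) u₀) (hd : Literature.Analysis.FluidPDE.HasRapidSpatialDecay u₀), Literature.Analysis.FluidPDE.NSWave0.IsDivFree u₀ → (∀ T₀ : ℝ, 0 < T₀ → ∃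
/-- item stmt-NavierStokesRegularity-10579 · crux · rank 4 · open · by planner
why it might fail: PM² size is blind to (−1)-homogeneous profiles: a backward discretely self-similar blow-up with |x|^{-1} tails keeps the envelope bounded, and excluding DSS blow-up is open (only exact self-similar, C_tL³-DSS, q<∞ or small-jump endpoints known); Tao's truncated dyadic chain is an ℓ^∞-critical ride.
sources: CannoneKarch2004, EscauriazaSereginSverak2003, GallagherKochPlanchon2016, Albritton2018, CheskidovShvydkoy2010, Tsai1998
[crux] (B) BOUNDED-ENVELOPE CONTINUATION = the q=∞ endpoint criterion, landing directly in the Clay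
matrix (rev-2 reroute: no Tao-class vocabulary in the route file, imports NSFourierMild +
NSFourierData only). If at every horizon T₀ the critical envelope sup_ξ|ξ|²‖V(t,ξ)‖ of all
Fourier-mild solutions from a = 𝓕⁻u₀ on [0,T], T ≤ T₀, is bounded, then u₀ launches a GLOBAL smooth
solution with bounded energy (∃ u p, IsSmoothOnHalfSpace u ∧ IsSmoothOnHalfSpace p ∧
IsNavierStokesSolution ν 0 u₀ u p ∧ HasBoundedEnergy u — Fefferman (1)(2)(3)(6)(7) for that datum).
Intended proof shape: bounded envelope ⇒ the Fourier-mild / Tao-class solution continues past every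
T (the OPEN part: exclude envelope-RIDING blow-up); then patch Tao-class solutions on [0,n+1] by the
PROVED IsTaoSolutionOn.global_of_nat (TaoClassGlobal.lean) and convert by
isNavierStokesSolution_and_smooth_iff (NSKatoToClayHolds pattern:
exists_isTaoSolutionOn_fourierPiece, IsFourierMild.glue, IsTaoSolutionOn.glue) — all imported by the
prover's Theorems file, not by this route. Contrapositive: at a first blow-up time T* the envelope
is unbounded as t↑T*. Known neighbours: L^∞_t L³ (EscauriazaSereginSverak2003; in-tree ess_en -/
@[route_item "route-NavierStokesRegularity-FrozenSignCascade", crux]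
def BoundedEnvelopeContinuation : Prop :=
  ∀ ν : ℝ, 0 < ν → ∀ (u₀ : EuclideanSpace ℝ (Fin 3) → EuclideanSpace ℝ (Fin 3)) (hu : ContDiff ℝ (⊤ : ℕ∞) u₀) (hd : Literature.Analysis.FluidPDE.HasRapidSpatialDecay u₀), Literature.Analysis.FluidPDE.NSWave0.IsDivFree u₀ → (∀ T₀ : ℝ, 0 < T₀ → ∃ C : ℝ, ∀ T : ℝ, T ≤ T₀ → ∀ V : ℝ → EuclideanSpace ℝ (Fin 3) → Fin 3 → ℂ, Literature.Analysis.FluidPDE.FourierNS.IsFourierMild (4 * Real.pi ^ 2 * ν) 4 0 T V → V 0 = Literature.Analysis.FluidPDE.FourierNS.fourierData hu hd → ∀ t ∈ Set.Icc 0 T, ∀ ξ : EuclideanSpace ℝ (Fin 3), ‖ξ‖ ^ 2 * ‖V t ξ‖ ≤ C) → ∃ (u : ℝ → EuclideanSpace ℝ (Fin 3) → EuclideanSpace ℝ (Fin 3)) (p : ℝ → EuclideanSpace ℝ (Fin 3) → ℝ), Literature.Analysis.FluidPDE.IsSmoothOnHalfSpace u ∧ Literature.Analysis.FluidPDE.IsSmoothOnHalfSpace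 p ∧ Literature.Analysis.FluidPDE.IsNavierStokesSolution ν 0 u₀ u p ∧ Literature.Analysis.FluidPDE.HasBoundedEnergy u

-- earlier TightEnvelopeContinuation (stmt-NavierStokesRegularity-1552, replaced 2026-08-15T16:18:48Z -> stmt-NavierStokesRegularity-10580): retired by None — ∀ ν : ℝ, 0 < ν → ∀ (u₀ : EuclideanSpace ℝ (Fin 3) → EuclideanSpace ℝ (Fin 3)) (hu : ContDiff ℝ (⊤ : ℕ∞) u₀) (hd : Literature.Analysis.FluidPDE.HasRapidSpatialDecay u₀), Literature.Analysis.FluidPDE.NSWave0.IsDivFree u₀ → (∀ T₀ : ℝ, 0 < T₀ → ∀ ε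
/-- item stmt-NavierStokesRegularity-10580 · support · rank 9 · open · by planner
sources: LemarieRieusset2016, LeJanSznitman1997, CheskidovShvydkoy2010
[support] TIGHT-ENVELOPE CONTINUATION (known-type lemma toward crux B; rev 2 lands in the Clay
matrix). If for every horizon T₀ and every ε>0 there is R with |ξ|²‖V(t,ξ)‖ ≤ ε for ‖ξ‖ ≥ R along
all Fourier-mild solutions from a on [0,T], T ≤ T₀, then u₀ launches a global smooth bounded-energy
solution (∃ u p, IsSmoothOnHalfSpace u ∧ IsSmoothOnHalfSpace p ∧ IsNavierStokesSolution ν 0 u₀ u p ∧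
HasBoundedEnergy u). Mechanism = LemarieRieusset2016 Thm 8.21 and its proof (book p.190): in the
closure of 𝒮 in Ḃ²_{PM,∞} the Fourier-side fixed point in F = |ξ|^{-5/2}L^∞_ξ with time weight
(νt)^{1/4} has existence time controlled by limsup_{A→∞} sup_{|ξ|>A}|ξ|²|û₀(ξ)| together with the
low-frequency part, so a tightness modulus uniform up to T* gives a uniform restart time; low
frequencies are bounded along mild solutions by the energy inequality (|N(V,V)(ξ)| ≲ |ξ|·‖u‖²_{L²});
restart, glue and synthesis to the Tao class as in NSKatoToClayHolds
(exists_isTaoSolutionOn_fourierPiece, IsFourierMild.glue, FourierDatum.restart), then patch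
[0,n+1]-slabs by IsTaoSolutionOn.global_of_nat and convert by isNavierStokesSolution_and_smooth_iff
(all proved; imported by the Theorems file). Refuter caveat -/
@[route_item "route-NavierStokesRegularity-FrozenSignCascade"]
def TightEnvelopeContinuation : Prop :=
  ∀ ν : ℝ, 0 < ν → ∀ (u₀ : EuclideanSpace ℝ (Fin 3) → EuclideanSpace ℝ (Fin 3)) (hu : ContDiff ℝ (⊤ : ℕ∞) u₀) (hd : Literature.Analysis.FluidPDE.HasRapidSpatialDecay u₀), Literature.Analysis.FluidPDE.NSWave0.IsDivFree u₀ → (∀ T₀ : ℝ, 0 < T₀ → ∀ ε : ℝ, 0 < ε → ∃ R : ℝ, ∀ T : ℝ, T ≤ T₀ → ∀ V : ℝ → EuclideanSpace ℝ (Fin 3) → Fin 3 → ℂ, Literature.Analysis.FluidPDE.FourierNS.IsFourierMild (4 * Real.pi ^ 2 * ν) 4 0 T V → V 0 = Literature.Analysis.FluidPDE.FourierNS.fourierData hu hd → ∀ t ∈ Set.Icc 0 T, ∀ ξ : EuclideanSpace ℝ (Fin 3), R ≤ ‖ξ‖ → ‖ξ‖ ^ 2 * ‖V t ξ‖ ≤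 ε) → ∃ (u : ℝ → EuclideanSpace ℝ (Fin 3) → EuclideanSpace ℝ (Fin 3)) (p : ℝ → EuclideanSpace ℝ (Fin 3) → ℝ), Literature.Analysis.FluidPDE.IsSmoothOnHalfSpace u ∧ Literature.Analysis.FluidPDE.IsSmoothOnHalfSpace p ∧ Literature.Analysis.FluidPDE.IsNavierStokesSolution ν 0 u₀ u p ∧ Literature.Analysis.FluidPDE.HasBoundedEnergy u

-- earlier Assembly (stmt-NavierStokesRegularity-1554, replaced 2026-08-15T16:18:48Z -> stmt-NavierStokesRegularity-10581): retired by None — EnvelopeBound → BoundedEnvelopeContinuation → TaoClassGlobalToClay → NavierStokesRegularity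
/-- item stmt-NavierStokesRegularity-10581 · assembly · rank 1 · open · by planner
sources: Fefferman2000, LemarieRieusset2016
[assembly] EnvelopeBound → BoundedEnvelopeContinuation → NavierStokesRegularity. PURE LOGIC — it is
the deciding theorem `closes` of this file (fix ν, u₀; A gives the envelope bounds at every horizon,
B turns them into the Clay conclusion for u₀; axioms propext/Classical.choice/Quot.sound).
TwoClusterEnvelopeBound is a special case of EnvelopeBound (twoCluster_of_envelope in the planner's
Sketch.lean) and TightEnvelopeContinuation a support lemma toward B; neither is needed by the chain.
Rev 2: TaoClassGlobalToClay dropped (folded into B). -/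
@[route_item "route-NavierStokesRegularity-FrozenSignCascade"]
def Assembly : Prop :=
  EnvelopeBound → BoundedEnvelopeContinuation → NavierStokesRegularity

/-! D-0027 §2.1 — DECIDING THEOREM (planner-authored via `route open/edit --closes-file`; by planner-rbadge-NavierStokesRegularity-FrozenSi-e3cf0f4c-g4-0 2026-08-15T16:18:48Z):
its hypotheses are this route's items and its conclusion the sub-problem Statement (glue_lint), and it elaborates with this file. -/

@[closes "route-NavierStokesRegularity-FrozenSignCascade"] theorem closes (hA : EnvelopeBound) (hB : BoundedEnvelopeContinuation) : NavierStokesRegularity := by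
  intro ν hν u₀ hu hdiv hd
  exact hB ν hν u₀ hu hd hdiv (hA ν hν u₀ hu hd hdiv)

end Summit.NavierStokesRegularity.NavierStokesRegularity.Theses.FrozenSignCascade
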